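import Mathlib.RingTheory.MvPolynomial.WeightedHomogeneous
import Mathlib.RingTheory.FiniteType
import Mathlib.RingTheory.RegularLocalRing.Polynomial
import Mathlib.Algebra.Order.Antidiag.Finsupp
import Literature.AlgebraicGeometry.Resolution.AffineBlowupAlgebra
import Literature.AlgebraicGeometry.Resolution.AffineBlowup
import Summits.ResolutionOfSingularities.ResolutionOfSingularities.Theorems.FrobeniusLadderFRationalResolutionVeroneseRetract
import HarnessLib

/-!
# The Segre ring `SR[a, b] = k[xᵢyⱼ] ⊆ k[x, y]` is a direct summand

Support file for crux stmt-ResolutionOfSingularities-15317 (`FrobeniusLadder.FRationalResolution`), line `redirect`,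
lead c5, CONE PROGRAMME (rung 4′ in all dimensions on the Veronese cones `V(n,r) = Spec k[χᵈ : |d| = r]`
and on the Segre cones `Spec k[xᵢyⱼ]`).
Given the membership criterion for the Segre ring `SR[a, b] = k[xᵢyⱼ : i < a, j < b]` inside
`SP[a, b] = k[x₁,…,x_a, y₁,…,y_b]` (a polynomial lies in it iff every monomial of its support is
*balanced*: its total `x`-degree equals its total `y`-degree), we prove that `SR[a, b]` is a direct
summand of `SP[a, b]`: there is an additive retraction `ρ : SP[a, b] →+ SR[a, b]` of the inclusion which
is `SR[a, b]`-linear. The map `ρ` is the Reynolds operator of the torus `𝔾ₘ` acting with weight `+1` on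
the `xᵢ` and `−1` on the `yⱼ`, written on exponents (so it works over every field, in every
characteristic): the projection onto the weight-`0` component for the weight
`w = Sum.elim (fun _ => 1) (fun _ => -1) : Fin a ⊕ Fin b → ℤ`, i.e. onto the `k`-span of the balanced
monomials (`MvPolynomial.weightedHomogeneousComponent`). [folklore; BrunsHerzog1998 §6.1,
HochsterHuneke1990 discussion of Prop. 4.12]
-/

-- single-problem summit: the doubled namespace component is forced
set_option linter.dupNamespace false

noncomputable section

namespace Summit.ResolutionOfSingularities.ResolutionOfSingularities.Theorems.FRationalResolution

open MvPolynomial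
open Literature.AlgebraicGeometry.Resolution

section Cones

variable (k : Type) [Field k]

/-- The polynomial ring in two blocks of `a` and `b` variables `xᵢ = X (inl i)`, `yⱼ = X (inr j)`. -/
local notation3 "SP[" a ", " b "]" => MvPolynomial (Fin a ⊕ Fin b) k

/-- The Segre ring `k[xᵢyⱼ] ⊆ k[x, y]`: coordinate ring of the affine cone over the Segre embedding of
`ℙᵃ⁻¹ × ℙᵇ⁻¹`. -/
local notation3 "SR[" a ", " b "]" =>
  Algebra.adjoin k (Set.range (fun ij : Fin a × Fin b =>
    (MvPolynomial.X (Sum.inl ij.1) * MvPolynomial.X (Sum.inr ij.2) : MvPolynomial (Fin a ⊕ Fin b) k)))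

/-- For the torus weight `inl _ ↦ 1, inr _ ↦ -1 : Fin a ⊕ Fin b → ℤ`, the weight of an exponent vector
`d` is its total `x`-degree minus its total `y`-degree: `∑ᵢ d (inl i) • 1 + ∑ⱼ d (inr j) • (-1)`.
[folklore] -/
theorem segre_summand_weight_eq (a b : ℕ) (d : Fin a ⊕ Fin b →₀ ℕ) :
    Finsupp.weight (Sum.elim (fun _ : Fin a => (1 : ℤ)) (fun _ : Fin b => (-1 : ℤ))) d =
      ((∑ i : Fin a, d (Sum.inl i) : ℕ) : ℤ) - ((∑ j : Fin b, d (Sum.inr j) : ℕ) : ℤ) := by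
  rw [Finsupp.weight_apply, Finsupp.sum_fintype, Fintype.sum_sum_type]
  · simp only [Sum.elim_inl, Sum.elim_inr, nsmul_eq_mul, mul_one, mul_neg_one,
      Finset.sum_neg_distrib, Nat.cast_sum, sub_eq_add_neg]
  · exact fun _ => zero_smul ℕ _

/-- For the torus weight `inl _ ↦ 1, inr _ ↦ -1 : Fin a ⊕ Fin b → ℤ`, an exponent vector has weight `0`
iff it is balanced (total `x`-degree = total `y`-degree); `ℕ → ℤ` is injective. [folklore] -/
theorem segre_summand_weight_eq_zero_iff (a b : ℕ) (d : Fin a ⊕ Fin b →₀ ℕ) :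
    Finsupp.weight (Sum.elim (fun _ : Fin a => (1 : ℤ)) (fun _ : Fin b => (-1 : ℤ))) d = 0 ↔
      ∑ i : Fin a, d (Sum.inl i) = ∑ j : Fin b, d (Sum.inr j) := by
  rw [segre_summand_weight_eq, sub_eq_zero, Nat.cast_inj]

/-- **The Segre ring is a direct summand of the polynomial ring** (the Reynolds operator of the torus
`𝔾ₘ` acting with weights `+1` on the `xᵢ` and `−1` on the `yⱼ`, written on exponents, valid in every
characteristic). Given the membership criterion `hmem` (a polynomial lies in `SR[a, b]` iff every
monomial of its support is balanced), membership in `SR[a, b]` is the same as being weighted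
homogeneous of weight `0` for the weight `w = Sum.elim (fun _ => 1) (fun _ => -1) : Fin a ⊕ Fin b → ℤ`
(`segre_summand_weight_eq_zero_iff`). Hence the weight-`0` component
`E = MvPolynomial.weightedHomogeneousComponent w 0` is an additive map landing in `SR[a, b]`
(`weightedHomogeneousComponent_isWeightedHomogeneous`), fixing it
(`weightedHomogeneousComponent_eq_self`), and `SR[a, b]`-linear
(`veronese_retract_weightedHomogeneousComponent_mul`: in `coeff_mul` only the pairs whose first factor
has weight `0` contribute); `ρ f := ⟨E f, _⟩` is the required retraction. [folklore; BrunsHerzog1998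
§6.1, HochsterHuneke1990 Prop. 4.12 context] -/
theorem stub_segre_retract (a b : ℕ)
    (hmem : ∀ f : SP[a, b], f ∈ SR[a, b] ↔
      ∀ d ∈ f.support, ∑ i : Fin a, d (Sum.inl i) = ∑ j : Fin b, d (Sum.inr j)) :
    ∃ ρ : SP[a, b] →+ ↥SR[a, b], (∀ t : ↥SR[a, b], ρ (t : SP[a, b]) = t) ∧
      ∀ (t : ↥SR[a, b]) (g : SP[a, b]), ρ ((t : SP[a, b]) * g) = t * ρ g := by
  -- membership in the Segre ring = weighted homogeneity of weight `0` for the torus weight `(1, -1)`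
  have hhom : ∀ f : SP[a, b], f ∈ SR[a, b] ↔
      IsWeightedHomogeneous (Sum.elim (fun _ : Fin a => (1 : ℤ)) (fun _ : Fin b => (-1 : ℤ))) f 0 := by
    intro f
    rw [hmem f]
    constructor
    · intro h d hd
      exact (segre_summand_weight_eq_zero_iff a b d).mpr (h d (MvPolynomial.mem_support_iff.mpr hd))
    · intro h d hd
      exact (segre_summand_weight_eq_zero_iff a b d).mp (h (MvPolynomial.mem_support_iff.mp hd))
  have hE : ∀ f : SP[a, b], weightedHomogeneousComponent
      (Sum.elim (fun _ : Fin a => (1 : ℤ)) (fun _ : Fin b => (-1 : ℤ))) 0 f ∈ SR[a, b] := fun f =>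
    (hhom _).mpr (weightedHomogeneousComponent_isWeightedHomogeneous 0 f)
  refine ⟨{ toFun := fun f => ⟨weightedHomogeneousComponent
              (Sum.elim (fun _ : Fin a => (1 : ℤ)) (fun _ : Fin b => (-1 : ℤ))) 0 f, hE f⟩
            map_zero' := Subtype.ext (map_zero _)
            map_add' := fun f g => Subtype.ext (map_add _ f g) }, fun t => Subtype.ext ?_,
    fun t g => Subtype.ext ?_⟩
  · exact weightedHomogeneousComponent_eq_self ((hhom _).mp t.2)
  · exact veronese_retract_weightedHomogeneousComponent_mul ((hhom _).mp t.2) 0 g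

end Cones

end Summit.ResolutionOfSingularities.ResolutionOfSingularities.Theorems.FRationalResolution

end
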